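import Mathlib
import HarnessLib
import Summits.NavierStokesRegularity.NavierStokesRegularity.Theorems.PoloidalWindowDoorLrcModEntireTHCertDecode

/-!
# ARM-C cell T1′ (e,q) = (4,3), ALL real tilts γ ≠ 0 (C1a ∀γ) (γ = pinned letter g; ∂ₜ-blind identities; eng-2 psec kill export T1_4_3_gsym; content removed automatically, economical variant) — STATE S(4a) (after step 62) DATA part 18 of 27 (row-encoded polynomials; generated by stage2lean.py)

Row-encoded polynomials (`…THCertDecode` format); decoded and replayed in the stage files of `PoloidalWindowDoorLrcModEntireJetCertPsatzElimCellT1E4Q3Gall`.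
WHAT THIS IS NOT: not a statement about Navier–Stokes; data of an exact census row of an ansatz class. [folklore]
-/

-- the summit and its single sub-problem share the name (CONVENTIONS §1), as in every Theorems file
set_option linter.dupNamespace false

namespace Summit.NavierStokesRegularity.NavierStokesRegularity.Theorems.PoloidalWindowDoorLrcModEntireJetCertPsatzElimCellT1E4Q3GallS4aData18

/-- st4arows 146 (6 terms; rows `[sgn, num, den, letter, exp, …]`). [folklore] -/
def st4arows_146 : List (List ℕ) := [[0, 6, 1, 155, 1], [0, 2, 1, 153, 1], [0, 1, 1, 18, 1, 22, 1], [0, 6, 1, 18, 1, 19, 1, 20, 1], [0, 1, 1, 15, 1, 21, 1], [0, 3, 1, 15, 1, 20, 2]]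

end Summit.NavierStokesRegularity.NavierStokesRegularity.Theorems.PoloidalWindowDoorLrcModEntireJetCertPsatzElimCellT1E4Q3GallS4aData18
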